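import Mathlib.Algebra.BigOperators.Fin
import Mathlib.Data.Fintype.Pi
import Mathlib.Data.Fintype.Prod
import Mathlib.Logic.Equiv.Fin.Basic
import Literature.Computability.Complexity.SymmetricCircuit

/-!
# The canonical DNF as a symmetric straight-line circuit (negative-side support, crux `stmt-PneNP-2143`)

For a finite set of variables `ι` and `f : (ι → Bool) → Bool`, the DNF — one `¬` gate per variable,
one `∧` gate (minterm) per assignment, one `∨` gate over the accepted minterms — is a `tcBasis`
straight-line circuit computing `f` (`dnfCircuit_computes`), and every permutation `π` of the
variables with `f (x ∘ π) = f x` extends to an automorphism of it (`dnfCircuit_isInducedAut`,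
`dnfCircuit_isVarSymmetric`): gates are permuted by `π` on variables, `y ↦ y ∘ π⁻¹` on minterms,
and the disjunction is fixed. This file: the program, its well-formedness and its semantics;
`InvariantDNFSymmetry.lean`: the automorphisms; `InvariantDNFHam.lean`: the consequences for the cruxes
(every invariant matrix function, in particular `HAM_m`, has a symmetric circuit at every `m`;
`HamCompiles ↔ (NP ⊆ P → ¬WindowHam)`).
-/

namespace Summit.PneNP.PneNP.Theorems.WindowHam.Negative

open Literature.Computability.Complexity

section DNF

variable {ι : Type*} [Fintype ι] [DecidableEq ι] (f : (ι → Bool) → Bool)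

/-- Enumeration of the variables. -/
noncomputable def eIn (ι : Type*) [Fintype ι] : Fin (Fintype.card ι) ≃ ι := (Fintype.equivFin ι).symm

/-- Enumeration of the assignments. -/
noncomputable def eAs (ι : Type*) [Fintype ι] [DecidableEq ι] :
    Fin (Fintype.card (ι → Bool)) ≃ (ι → Bool) := (Fintype.equivFin (ι → Bool)).symm

/-- Indices of the accepted assignments. -/
noncomputable def accSet : Finset (Fin (Fintype.card (ι → Bool))) :=
  Finset.univ.filter fun k => f (eAs ι k) = true

/-- Enumeration of the accepted assignments. -/
noncomputable def accEquiv : Fin (accSet f).card ≃ {k // k ∈ accSet f} := (accSet f).equivFin.symm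

/-- The negation gate reading variable number `a`. -/
noncomputable def notGate (a : Fin (Fintype.card ι)) : Gate ι :=
  ⟨1, GateFn.not.2, fun _ => Sum.inl (eIn ι a)⟩

/-- The argument wires of the minterm of the assignment `y`: variable `a` positively (the input
wire) if `y` sets it, else negatively (the `¬` gate number `a`). -/
noncomputable def mintermArgs (y : ι → Bool) (a : Fin (Fintype.card ι)) : ι ⊕ ℕ :=
  if y (eIn ι a) = true then Sum.inl (eIn ι a) else Sum.inr (a : ℕ)

/-- The minterm (an `∧` gate of arity `|ι|`) of the assignment `y`. -/
noncomputable def mintermGate (y : ι → Bool) : Gate ι :=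
  ⟨Fintype.card ι, (GateFn.and (Fintype.card ι)).2, mintermArgs y⟩

/-- The argument wires of the final `∨` gate: the minterms of the accepted assignments. -/
noncomputable def orArgs (c : Fin (accSet f).card) : ι ⊕ ℕ :=
  Sum.inr (Fintype.card ι + ((accEquiv f c).1 : ℕ))

/-- The final `∨` gate. -/
noncomputable def orGate : Gate ι :=
  ⟨(accSet f).card, (GateFn.or (accSet f).card).2, orArgs f⟩

/-- Gate number `j` of the DNF program: `¬` gates, then minterms, then the `∨` gate. -/
noncomputable def dnfGateAt (j : ℕ) : Gate ι :=
  if h : j < Fintype.card ι then notGate ⟨j, h⟩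
  else if h2 : j - Fintype.card ι < Fintype.card (ι → Bool) then
    mintermGate (eAs ι ⟨j - Fintype.card ι, h2⟩)
  else orGate f

/-- Gate numbers below `|ι|` are negation gates. -/
theorem dnfGateAt_of_lt {j : ℕ} (h : j < Fintype.card ι) : dnfGateAt f j = notGate ⟨j, h⟩ := by
  unfold dnfGateAt
  rw [dif_pos h]

/-- Gate numbers in the middle block are minterms. -/
theorem dnfGateAt_of_mid {j : ℕ} (h : ¬ j < Fintype.card ι)
    (h2 : j - Fintype.card ι < Fintype.card (ι → Bool)) :
    dnfGateAt f j = mintermGate (eAs ι ⟨j - Fintype.card ι, h2⟩) := by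
  unfold dnfGateAt
  rw [dif_neg h, dif_pos h2]

/-- The last gate number is the disjunction. -/
theorem dnfGateAt_of_ge {j : ℕ} (h : ¬ j < Fintype.card ι)
    (h2 : ¬ j - Fintype.card ι < Fintype.card (ι → Bool)) : dnfGateAt f j = orGate f := by
  unfold dnfGateAt
  rw [dif_neg h, dif_neg h2]

/-- Gate number `|ι| + k` is the minterm of assignment number `k`. -/
theorem dnfGateAt_mid (k : Fin (Fintype.card (ι → Bool))) :
    dnfGateAt f (Fintype.card ι + k) = mintermGate (eAs ι k) := by
  rw [dnfGateAt_of_mid f (by omega) (by rw [Nat.add_sub_cancel_left]; exact k.2)]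
  congr 2
  exact Fin.ext (Nat.add_sub_cancel_left _ _)

/-- Gate number `|ι| + 2^{|ι|}` is the disjunction. -/
theorem dnfGateAt_last :
    dnfGateAt f (Fintype.card ι + Fintype.card (ι → Bool)) = orGate f :=
  dnfGateAt_of_ge f (by omega) (by rw [Nat.add_sub_cancel_left]; exact lt_irrefl _)

omit [Fintype ι] [DecidableEq ι] in
/-- Transport of an acyclicity bound along an equality of gates. -/
theorem args_lt_of_eq {g g' : Gate ι} (h : g = g') {j : ℕ}
    (H : ∀ (a : Fin g'.arity) (k : ℕ), g'.args a = .inr k → k < j) :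
    ∀ (a : Fin g.arity) (k : ℕ), g.args a = .inr k → k < j := by
  subst h
  exact H

omit [DecidableEq ι] in
/-- Negation gates read inputs only. -/
theorem notGate_args (b : Fin (Fintype.card ι)) (j : ℕ) :
    ∀ (a : Fin (notGate b : Gate ι).arity) (k : ℕ), (notGate b : Gate ι).args a = .inr k → k < j := by
  intro a k hk
  exact absurd hk Sum.inl_ne_inr

omit [DecidableEq ι] in
/-- Minterms read inputs and negation gates only. -/
theorem mintermGate_args (y : ι → Bool) {j : ℕ} (hj : Fintype.card ι ≤ j) :
    ∀ (a : Fin (mintermGate y).arity) (k : ℕ), (mintermGate y).args a = .inr k → k < j := by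
  intro a k hk
  change mintermArgs y a = Sum.inr k at hk
  unfold mintermArgs at hk
  split_ifs at hk with hy
  have ha : (a : ℕ) < Fintype.card ι := a.2
  rw [Sum.inr.injEq] at hk
  omega

/-- The disjunction reads minterms only. -/
theorem orGate_args {j : ℕ} (hj : Fintype.card ι + Fintype.card (ι → Bool) ≤ j) :
    ∀ (a : Fin (orGate f).arity) (k : ℕ), (orGate f).args a = .inr k → k < j := by
  intro a k hk
  change orArgs f a = Sum.inr k at hk
  unfold orArgs at hk
  rw [Sum.inr.injEq] at hk
  have := ((accEquiv f a).1).2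
  omega

/-- Acyclicity of the DNF program. -/
theorem dnfGateAt_wf (j : ℕ) :
    ∀ (a : Fin (dnfGateAt f j).arity) (k : ℕ), (dnfGateAt f j).args a = .inr k → k < j := by
  by_cases h : j < Fintype.card ι
  · exact args_lt_of_eq (dnfGateAt_of_lt f h) (notGate_args _ j)
  · by_cases h2 : j - Fintype.card ι < Fintype.card (ι → Bool)
    · exact args_lt_of_eq (dnfGateAt_of_mid f h h2) (mintermGate_args _ (Nat.not_lt.1 h))
    · exact args_lt_of_eq (dnfGateAt_of_ge f h h2) (orGate_args f (by omega))

/-- **The canonical DNF of `f` as a straight-line `tcBasis`-circuit**: `|ι|` negation gates,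
`2^{|ι|}` minterms, one disjunction. [folklore] -/
noncomputable def dnfCircuit : Circuit ι where
  gates := List.ofFn fun j : Fin (Fintype.card ι + Fintype.card (ι → Bool) + 1) => dnfGateAt f j
  output := Sum.inr (Fintype.card ι + Fintype.card (ι → Bool))
  wf j hj := args_lt_of_eq (List.getElem_ofFn hj) (dnfGateAt_wf f j)
  wf_output k hk := by
    cases hk
    simp only [List.length_ofFn]
    omega

/-- Number of gates of the DNF. -/
theorem dnfCircuit_length :
    (dnfCircuit f).gates.length = Fintype.card ι + Fintype.card (ι → Bool) + 1 := by
  simp only [dnfCircuit, List.length_ofFn]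

/-- Size of the DNF: `|ι| + 2^{|ι|} + 1`. -/
@[simp] theorem dnfCircuit_size :
    (dnfCircuit f).size = Fintype.card ι + Fintype.card (ι → Bool) + 1 :=
  dnfCircuit_length f

/-- Gate `j` of the DNF is `dnfGateAt f j`. -/
theorem dnfCircuit_getElem {j : ℕ} (hj : j < (dnfCircuit f).gates.length) :
    (dnfCircuit f).gates[j] = dnfGateAt f j := by
  simp only [dnfCircuit, List.getElem_ofFn]

/-- The DNF is a circuit over `acBasis ⊆ tcBasis`. -/
theorem dnfCircuit_isOver_acBasis : (dnfCircuit f).IsOver acBasis := by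
  intro g hg
  simp only [dnfCircuit, List.mem_ofFn] at hg
  obtain ⟨j, rfl⟩ := hg
  unfold dnfGateAt
  split_ifs
  · exact Or.inl rfl
  · exact Or.inr (Set.mem_iUnion.2 ⟨_, Or.inl rfl⟩)
  · exact Or.inr (Set.mem_iUnion.2 ⟨_, Or.inr rfl⟩)

/-- The DNF is a circuit over the threshold basis. -/
theorem dnfCircuit_isOver_tcBasis : (dnfCircuit f).IsOver tcBasis :=
  (dnfCircuit_isOver_acBasis f).mono acBasis_subset_tcBasis

/-! ### Semantics -/

/-- Values of the negation layer. -/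
theorem dnf_val_not (x : ι → Bool) (a : Fin (Fintype.card ι)) :
    (transcript x [] (dnfCircuit f).gates).getD a false = !x (eIn ι a) := by
  have ha : (a : ℕ) < (dnfCircuit f).gates.length := by rw [dnfCircuit_length]; omega
  rw [getD_transcript_eq_gateValue _ x a ha, dnfCircuit_getElem, dnfGateAt_of_lt f a.2]
  simp [gateValue, wireVal, notGate, GateFn.not]

/-- Values of the minterm layer: minterm `y` fires iff the input is `y`. -/
theorem dnf_val_minterm (x : ι → Bool) (k : Fin (Fintype.card (ι → Bool))) :
    (transcript x [] (dnfCircuit f).gates).getD (Fintype.card ι + k) false = decide (x = eAs ι k) := by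
  have hk : Fintype.card ι + k < (dnfCircuit f).gates.length := by rw [dnfCircuit_length]; omega
  rw [getD_transcript_eq_gateValue _ x _ hk, dnfCircuit_getElem, dnfGateAt_mid]
  simp only [gateValue, mintermGate, GateFn.and]
  refine decide_eq_decide.2 ⟨fun h => ?_, fun h a => ?_⟩
  · funext i
    have hi := h ((eIn ι).symm i)
    unfold mintermArgs at hi
    rw [Equiv.apply_symm_apply] at hi
    by_cases hy : eAs ι k i = true
    · rw [if_pos hy] at hi
      simp only [wireVal] at hi
      rw [hi, hy]
    · rw [if_neg hy] at hi
      simp only [wireVal] at hi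
      rw [dnf_val_not, Equiv.apply_symm_apply] at hi
      rw [Bool.eq_false_iff.2 hy]
      simpa using hi
  · subst h
    unfold mintermArgs
    by_cases hy : eAs ι k (eIn ι a) = true
    · rw [if_pos hy]
      simpa [wireVal] using hy
    · rw [if_neg hy]
      simp only [wireVal]
      rw [dnf_val_not]
      simpa using hy

/-- Value of the output gate: the DNF fires iff `f` accepts. -/
theorem dnf_val_or (x : ι → Bool) :
    (transcript x [] (dnfCircuit f).gates).getD (Fintype.card ι + Fintype.card (ι → Bool)) false
      = f x := by
  have hk : Fintype.card ι + Fintype.card (ι → Bool) < (dnfCircuit f).gates.length := by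
    rw [dnfCircuit_length]; omega
  rw [getD_transcript_eq_gateValue _ x _ hk, dnfCircuit_getElem, dnfGateAt_last]
  simp only [gateValue, orGate, GateFn.or, orArgs, wireVal]
  have key : (∃ c : Fin (accSet f).card,
      (transcript x [] (dnfCircuit f).gates).getD (Fintype.card ι + ((accEquiv f c).1 : ℕ)) false
        = true) ↔ f x = true := by
    constructor
    · rintro ⟨c, hc⟩
      rw [dnf_val_minterm, decide_eq_true_eq] at hc
      have hmem := Finset.mem_filter.1 (accEquiv f c).2
      rw [hc]
      exact hmem.2
    · intro hx
      have hmem : (eAs ι).symm x ∈ accSet f :=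
        Finset.mem_filter.2 ⟨Finset.mem_univ _, by simpa using hx⟩
      refine ⟨(accEquiv f).symm ⟨_, hmem⟩, ?_⟩
      rw [dnf_val_minterm, decide_eq_true_eq]
      simp
  by_cases hx : f x = true
  · rw [hx]
    exact decide_eq_true (key.2 hx)
  · rw [Bool.eq_false_iff.2 hx]
    exact decide_eq_false fun h => hx (key.1 h)

/-- **The DNF computes `f`.** [folklore] -/
theorem dnfCircuit_computes : (dnfCircuit f).Computes f := by
  intro x
  rw [eval_eq_wireVal]
  exact dnf_val_or f x

end DNF

end Summit.PneNP.PneNP.Theorems.WindowHam.Negative
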